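import Literature.Probability.Process.SimpleIntegralMartingale
import Literature.Probability.Process.DoobMaximalIneq
import Literature.Probability.Process.UCPLimit
import Literature.Probability.Process.ItoIntegralConstruction
import HarnessLib

/-!
# Construction of the Itô integral, II: u.c.p. limits of elementary integrals

The core of the construction of the stochastic integral `∫ H dB` against a continuous
square-integrable martingale `B` with `⟨B⟩_t = t` (a Brownian motion), in the characterised
form `Literature.Probability.Process.IsItoIntegral` of `ItoCalculus.lean` and for a *raw* filtration:

* `SimpleProcess.measure_exists_le_abs_integral_le` — the basic estimate for a simple `K`:
  `μ {sup_{s ≤ t} |(K·B)_s| ≥ ε} ≤ μ {∫₀ᵗ K² ds > η} + η / ε²` (truncate `K` at the level `η` of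
  its time integral, Doob's weak-`L²` inequality, Itô's isometry);
* `SimpleProcess.measure_exists_le_abs_integral_sub_le` — the same for `(Hₙ·B) - (Gₙ'·B)` in
  terms of the approximation errors `∫₀ᵗ (Hₙ - H)²`, `∫₀ᵗ (Gₙ' - H)²`;
* `Literature.Probability.Process.tendsto_measure_integral_sub_of_isApproxSeq` — two approximating sequences of the same
  integrand have u.c.p.-equivalent elementary integrals;
* `Literature.Probability.Process.exists_ucpLimit_integral` — **existence of the u.c.p. limit**: along any approximating
  sequence the elementary integrals are u.c.p.-Cauchy, hence (by `exists_tendstoUCP_of_cauchy`)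
  converge u.c.p. to a strongly adapted process `J` with a.s. continuous paths, `J 0 = 0`, which
  is the u.c.p. limit along *every* approximating sequence and the a.s. locally uniform limit of
  a subsequence;
* `Literature.Probability.Process.martingale_limit_of_tendsto_approxErr` — if the approximation holds in
  `L²(ds ⊗ μ)`-norm on every `[0, t]`, then `(Hₙ·B)_t → J_t` in `L²`, `J_t ∈ L²` and `J` is a
  **martingale** (for the raw filtration; no usual conditions).

## References

* D. Revuz, M. Yor, *Continuous Martingales and Brownian Motion* (3rd ed., 1999), Ch. IV,
  Thm (2.2) (the map `K ↦ K·M` extends to an isometry from `L²(M)` into `H²₀`), Prop. (2.13)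
  and the proof of Thm (2.12) (convergence in probability, uniformly on compact intervals, via
  localisation), Def. (2.9) (`L²_loc`).
* K. Itô, *Stochastic integral*, Proc. Imp. Acad. Tokyo 20 (1944), 519–524.
-/

open MeasureTheory ProbabilityTheory Filter Finset
open scoped NNReal ENNReal Topology

namespace Literature.Probability.Process

variable {Ω : Type*} {m : MeasurableSpace Ω} {𝓕 : Filtration ℝ≥0 m} {μ : Measure Ω}

/-! ### u.c.p. bookkeeping -/

/-- u.c.p. convergence is transferred along u.c.p.-vanishing differences: if `Y n → J` u.c.p.
and `sup_{s ≤ t} |Z n s - Y n s| → 0` in probability for every `t`, then `Z n → J` u.c.p.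
(used in `exists_ucpLimit_integral` to pass from one approximating sequence to all).
[folklore] -/
theorem TendstoUCP.of_sub {Y Z : ℕ → ℝ≥0 → Ω → ℝ} {J : ℝ≥0 → Ω → ℝ} (hY : TendstoUCP Y J μ)
    (hZY : ∀ (t : ℝ≥0) (ε : ℝ), 0 < ε →
      Tendsto (fun n ↦ μ {ω | ∃ s ≤ t, ε ≤ |Z n s ω - Y n s ω|}) atTop (𝓝 0)) :
    TendstoUCP Z J μ := by
  intro t ε hε
  have hε2 : 0 < ε / 2 := by positivity
  have hle : ∀ n, μ {ω | ∃ s ≤ t, ε ≤ |Z n s ω - J s ω|} ≤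
      μ {ω | ∃ s ≤ t, ε / 2 ≤ |Z n s ω - Y n s ω|} + μ {ω | ∃ s ≤ t, ε / 2 ≤ |Y n s ω - J s ω|} := by
    intro n
    refine (measure_mono ?_).trans (measure_union_le _ _)
    rintro ω ⟨s, hs, hεs⟩
    by_contra hcon
    simp only [Set.mem_union, Set.mem_setOf_eq, not_or, not_exists, not_and, not_le] at hcon
    have h1 := hcon.1 s hs
    have h2 := hcon.2 s hs
    have h3 : |Z n s ω - J s ω| ≤ |Z n s ω - Y n s ω| + |Y n s ω - J s ω| := abs_sub_le _ _ _
    linarith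
  have hlim : Tendsto (fun n ↦ μ {ω | ∃ s ≤ t, ε / 2 ≤ |Z n s ω - Y n s ω|} +
      μ {ω | ∃ s ≤ t, ε / 2 ≤ |Y n s ω - J s ω|}) atTop (𝓝 0) := by
    simpa using (hZY t (ε / 2) hε2).add (hY t (ε / 2) hε2)
  exact tendsto_of_tendsto_of_tendsto_of_le_of_le tendsto_const_nhds hlim (fun n ↦ bot_le) hle

/-- Two u.c.p. limits of the same sequence are indistinguishable (no continuity needed). This is
the general form of the argument of `IsItoIntegral.unique_holds` (`ItoCalculus.lean`), which should
become a one-line corollary of it in a later refactor; it is used downstream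
(`ItoIntegralStopping`) to identify stopped integrals.
Revuz–Yor, *Continuous Martingales and Brownian Motion* (1999), Ch. IV, Thm (2.2)
(uniqueness). [folklore] -/
theorem TendstoUCP.ae_eq {Y : ℕ → ℝ≥0 → Ω → ℝ} {J J' : ℝ≥0 → Ω → ℝ} (hJ : TendstoUCP Y J μ)
    (hJ' : TendstoUCP Y J' μ) : ∀ᵐ ω ∂μ, ∀ t, J t ω = J' t ω := by
  -- for fixed `t` and `ε > 0`, the deviation event is null
  have key : ∀ (t : ℝ≥0) (ε : ℝ), 0 < ε → μ {ω | ∃ s ≤ t, ε ≤ |J s ω - J' s ω|} = 0 := by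
    intro t ε hε
    have hε2 : 0 < ε / 2 := by positivity
    have hle : ∀ n, μ {ω | ∃ s ≤ t, ε ≤ |J s ω - J' s ω|} ≤
        μ {ω | ∃ s ≤ t, ε / 2 ≤ |Y n s ω - J s ω|} +
          μ {ω | ∃ s ≤ t, ε / 2 ≤ |Y n s ω - J' s ω|} := by
      intro n
      refine (measure_mono ?_).trans (measure_union_le _ _)
      rintro ω ⟨s, hs, hεs⟩
      by_contra hcon
      simp only [Set.mem_union, Set.mem_setOf_eq, not_or, not_exists, not_and, not_le] at hcon
      have h1 := hcon.1 s hs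
      have h2 := hcon.2 s hs
      have h3 : |J s ω - J' s ω| ≤ |Y n s ω - J s ω| + |Y n s ω - J' s ω| := by
        calc |J s ω - J' s ω| = |(Y n s ω - J' s ω) - (Y n s ω - J s ω)| := by ring_nf
          _ ≤ |Y n s ω - J' s ω| + |Y n s ω - J s ω| := abs_sub _ _
          _ = _ := add_comm _ _
      linarith
    have hlim : Tendsto (fun n ↦ μ {ω | ∃ s ≤ t, ε / 2 ≤ |Y n s ω - J s ω|} +
        μ {ω | ∃ s ≤ t, ε / 2 ≤ |Y n s ω - J' s ω|}) atTop (𝓝 0) := by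
      simpa using (hJ t (ε / 2) hε2).add (hJ' t (ε / 2) hε2)
    exact le_antisymm (ge_of_tendsto hlim (Eventually.of_forall hle)) bot_le
  have hsub : {ω | ¬ ∀ t, J t ω = J' t ω} ⊆
      ⋃ T : ℕ, ⋃ k : ℕ, {ω | ∃ s ≤ (T : ℝ≥0), 1 / ((k : ℝ) + 1) ≤ |J s ω - J' s ω|} := by
    intro ω hω
    simp only [Set.mem_setOf_eq, not_forall] at hω
    obtain ⟨t, ht⟩ := hω
    obtain ⟨T, hT⟩ := exists_nat_ge t
    have hpos : 0 < |J t ω - J' t ω| := abs_pos.2 (sub_ne_zero.2 ht)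
    obtain ⟨k, hk⟩ := exists_nat_one_div_lt hpos
    simp only [Set.mem_iUnion, Set.mem_setOf_eq]
    exact ⟨T, k, t, hT, hk.le⟩
  rw [ae_iff]
  exact measure_mono_null hsub <| (measure_iUnion_null_iff).2 fun T ↦
    (measure_iUnion_null_iff).2 fun k ↦ key _ _ (by positivity)

namespace SimpleProcess

/-! ### Time integrals of squared step processes, as expectations -/

/-- The squared step process is integrable on `[0, t]`, pathwise. [folklore] -/
theorem integrableOn_toProcess_sq (K : SimpleProcess m 𝓕) (t : ℝ≥0) (ω : Ω) :
    IntegrableOn (fun s : ℝ ↦ (K.toProcess s.toNNReal ω) ^ 2) (Set.Icc (0 : ℝ) t) := by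
  obtain ⟨C, hC⟩ := K.bounded
  refine Measure.integrableOn_of_bounded (M := (max C 0) ^ 2) measure_Icc_lt_top.ne
    (((K.measurable_toProcess_prod.comp (measurable_prodMk_left (x := ω))).pow_const 2).aestronglyMeasurable) ?_
  refine ae_of_all _ fun s ↦ ?_
  rw [Real.norm_eq_abs, abs_pow, sq_abs, ← sq_abs]
  exact pow_le_pow_left₀ (abs_nonneg _) (K.abs_toProcess_le hC s.toNNReal ω) 2

/-- The time integral `∫₀ᵗ K(s)² ds` of a squared step process, as the `ℝ≥0∞`-valued integral.
[folklore] -/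
theorem ofReal_setIntegral_toProcess_sq (K : SimpleProcess m 𝓕) (t : ℝ≥0) (ω : Ω) :
    ENNReal.ofReal (∫ s in Set.Icc (0 : ℝ) t, (K.toProcess s.toNNReal ω) ^ 2) =
      ∫⁻ s in Set.Icc (0 : ℝ) t, ENNReal.ofReal ((K.toProcess s.toNNReal ω) ^ 2) :=
  ofReal_integral_eq_lintegral_ofReal (K.integrableOn_toProcess_sq t ω)
    (ae_of_all _ fun _ ↦ sq_nonneg _)

/-- `ω ↦ ∫₀ᵗ K(s, ω)² ds` is measurable (a finite sum of squared values times constants).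
[folklore] -/
theorem measurable_setIntegral_toProcess_sq (K : SimpleProcess m 𝓕) (t : ℝ≥0) :
    Measurable fun ω ↦ ∫ s in Set.Icc (0 : ℝ) t, (K.toProcess s.toNNReal ω) ^ 2 := by
  have heq : (fun ω ↦ ∫ s in Set.Icc (0 : ℝ) t, (K.toProcess s.toNNReal ω) ^ 2) =
      fun ω ↦ ∑ i ∈ range (K.times.length - 1),
        K.value i ω ^ 2 * ((min t (K.time (i + 1)) : ℝ≥0) - (min t (K.time i) : ℝ≥0) : ℝ) :=
    funext fun ω ↦ K.setIntegral_toProcess_sq t ω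
  rw [heq]
  refine Finset.measurable_sum _ fun i hi ↦ ?_
  exact ((K.stronglyMeasurable_value' (by have := mem_range.1 hi; omega)).measurable.pow_const
    2).mul_const _

/-- `ω ↦ ∫₀ᵗ K(s, ω)² ds` is bounded, hence integrable (finite measure). [folklore] -/
theorem integrable_setIntegral_toProcess_sq [IsFiniteMeasure μ] (K : SimpleProcess m 𝓕)
    (t : ℝ≥0) : Integrable (fun ω ↦ ∫ s in Set.Icc (0 : ℝ) t, (K.toProcess s.toNNReal ω) ^ 2) μ := by
  obtain ⟨C, hC⟩ := K.bounded
  refine (integrable_const ((max C 0) ^ 2 * t)).mono'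
    (K.measurable_setIntegral_toProcess_sq t).aestronglyMeasurable (ae_of_all _ fun ω ↦ ?_)
  rw [Real.norm_eq_abs, abs_of_nonneg (setIntegral_nonneg measurableSet_Icc fun _ _ ↦ sq_nonneg _)]
  calc ∫ s in Set.Icc (0 : ℝ) t, (K.toProcess s.toNNReal ω) ^ 2
      ≤ ∫ s in Set.Icc (0 : ℝ) t, (max C 0) ^ 2 := by
        refine setIntegral_mono_on (K.integrableOn_toProcess_sq t ω)
          (integrableOn_const measure_Icc_lt_top.ne) measurableSet_Icc fun s _ ↦ ?_
        rw [← sq_abs]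
        exact pow_le_pow_left₀ (abs_nonneg _) (K.abs_toProcess_le hC s.toNNReal ω) 2
    _ = (max C 0) ^ 2 * t := by
        rw [setIntegral_const, Real.volume_real_Icc_of_le (by positivity), sub_zero, smul_eq_mul,
          mul_comm]

/-- **Itô's isometry in `ℝ≥0∞` form**: `∫⁻ (K·B)_t² dμ = ∫⁻ ∫⁻_{[0,t]} K(s)² ds dμ`.
Revuz–Yor, *Continuous Martingales and Brownian Motion* (1999), Ch. IV, Thm (2.2). [folklore] -/
theorem lintegral_integral_sq [IsFiniteMeasure μ] (K : SimpleProcess m 𝓕) {B : ℝ≥0 → Ω → ℝ}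
    (hB : Martingale B 𝓕 μ) (hBsq : Martingale (fun t ω ↦ B t ω ^ 2 - (t : ℝ)) 𝓕 μ)
    (hB2 : ∀ t, MemLp (B t) 2 μ) (t : ℝ≥0) :
    ∫⁻ ω, ENNReal.ofReal ((K.integral B t ω) ^ 2) ∂μ =
      ∫⁻ ω, (∫⁻ s in Set.Icc (0 : ℝ) t, ENNReal.ofReal ((K.toProcess s.toNNReal ω) ^ 2)) ∂μ := by
  rw [← ofReal_integral_eq_lintegral_ofReal (K.memLp_integral hB2 t).integrable_sq
      (ae_of_all _ fun ω ↦ sq_nonneg _), K.integral_integral_sq_eq_setIntegral hB hBsq hB2 t,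
    ofReal_integral_eq_lintegral_ofReal (K.integrable_setIntegral_toProcess_sq t)
      (ae_of_all _ fun ω ↦ setIntegral_nonneg measurableSet_Icc fun _ _ ↦ sq_nonneg _)]
  exact lintegral_congr fun ω ↦ K.ofReal_setIntegral_toProcess_sq t ω

/-! ### The basic estimate: truncation, Doob, isometry -/

section Estimate

variable [IsProbabilityMeasure μ] {B : ℝ≥0 → Ω → ℝ}

/-- **The basic estimate of the construction**: for a bounded simple `K`, `ε > 0`, `η > 0`,
`μ {∃ s ≤ t, ε ≤ |(K·B)_s|} ≤ μ {η < ∫₀ᵗ K² ds} + η / ε²`.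
On `{∫₀ᵗ K² ≤ η}` the integrals of `K` and of its truncation `K^η` (`SimpleProcess.truncate`)
agree; Doob's weak-`L²` inequality for the martingale `K^η·B` and the isometry give
`μ {sup |K^η·B| ≥ ε} ≤ E[(K^η·B)_t²]/ε² = E[∫₀ᵗ (K^η)²]/ε² ≤ η/ε²`.
Revuz–Yor, *Continuous Martingales and Brownian Motion* (1999), Ch. IV, proof of Thm (2.12)
and Prop. (2.13). [cite: RevuzYor1999, Ch. IV Thm (2.12)] -/
theorem measure_exists_le_abs_integral_le (K : SimpleProcess m 𝓕) (hB : Martingale B 𝓕 μ)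
    (hBsq : Martingale (fun t ω ↦ B t ω ^ 2 - (t : ℝ)) 𝓕 μ) (hB2 : ∀ t, MemLp (B t) 2 μ)
    (hBc : ∀ ω, Continuous (B · ω)) (t : ℝ≥0) {ε η : ℝ} (hε : 0 < ε) (hη : 0 < η) :
    μ {ω | ∃ s ≤ t, ε ≤ |K.integral B s ω|} ≤
      μ {ω | η < ∫ s in Set.Icc (0 : ℝ) t, (K.toProcess s.toNNReal ω) ^ 2} +
        ENNReal.ofReal (η / ε ^ 2) := by
  set K' := K.truncate t η with hK'
  -- inclusion of events
  have hsub : {ω | ∃ s ≤ t, ε ≤ |K.integral B s ω|} ⊆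
      {ω | η < ∫ s in Set.Icc (0 : ℝ) t, (K.toProcess s.toNNReal ω) ^ 2} ∪
        {ω | ∃ s ≤ t, ε ≤ |K'.integral B s ω|} := by
    rintro ω ⟨s, hs, hεs⟩
    by_cases hω : η < ∫ s in Set.Icc (0 : ℝ) t, (K.toProcess s.toNNReal ω) ^ 2
    · exact Or.inl hω
    · refine Or.inr ⟨s, hs, ?_⟩
      rwa [hK', K.integral_truncate_eq t η B (not_lt.1 hω) s]
  -- Doob for the truncated integral
  have hM : Martingale (K'.integral B) 𝓕 μ := K'.martingale_integral hB
  have hDoob := doob_sq_maximal_ineq_of_continuous hM (K'.memLp_integral hB2)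
    (ae_of_all _ fun ω ↦ K'.continuous_integral (hBc ω)) hε t
  -- isometry and the bound `∫₀ᵗ (K^η)² ≤ η`
  have hiso : ∫ ω, (K'.integral B t ω) ^ 2 ∂μ ≤ η := by
    rw [K'.integral_integral_sq_eq_setIntegral hB hBsq hB2 t]
    calc ∫ ω, (∫ s in Set.Icc (0 : ℝ) t, (K'.toProcess s.toNNReal ω) ^ 2) ∂μ
        ≤ ∫ _, η ∂μ := integral_mono (K'.integrable_setIntegral_toProcess_sq t)
            (integrable_const η) fun ω ↦ K.setIntegral_toProcess_truncate_sq_le t hη.le ω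
      _ = η := by simp
  calc μ {ω | ∃ s ≤ t, ε ≤ |K.integral B s ω|}
      ≤ μ {ω | η < ∫ s in Set.Icc (0 : ℝ) t, (K.toProcess s.toNNReal ω) ^ 2} +
          μ {ω | ∃ s ≤ t, ε ≤ |K'.integral B s ω|} :=
        (measure_mono hsub).trans (measure_union_le _ _)
    _ ≤ _ := by
        gcongr
        refine hDoob.trans (ENNReal.ofReal_le_ofReal ?_)
        exact div_le_div_of_nonneg_right hiso (by positivity)

/-- Pathwise comparison of the time integral of a difference of simple processes with the two
approximation errors: `∫₀ᵗ (Hₙ - Gₙ)² ≤ 2 ∫₀ᵗ (Hₙ - H)² + 2 ∫₀ᵗ (Gₙ - H)²` (in `ℝ≥0∞`).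
[folklore] -/
theorem ofReal_setIntegral_sub_sq_le (Hn Gn : SimpleProcess m 𝓕) {H : ℝ≥0 → Ω → ℝ}
    (hH : ∀ ω, Measurable fun s : ℝ ↦ H s.toNNReal ω) (t : ℝ≥0) (ω : Ω) :
    ENNReal.ofReal (∫ s in Set.Icc (0 : ℝ) t, ((Hn.sub Gn).toProcess s.toNNReal ω) ^ 2) ≤
      2 * (∫⁻ s in Set.Icc (0 : ℝ) t,
        ENNReal.ofReal ((Hn.toProcess s.toNNReal ω - H s.toNNReal ω) ^ 2)) +
      2 * (∫⁻ s in Set.Icc (0 : ℝ) t,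
        ENNReal.ofReal ((Gn.toProcess s.toNNReal ω - H s.toNNReal ω) ^ 2)) := by
  rw [(Hn.sub Gn).ofReal_setIntegral_toProcess_sq t ω]
  have hpt : ∀ s : ℝ, ENNReal.ofReal (((Hn.sub Gn).toProcess s.toNNReal ω) ^ 2) ≤
      2 * ENNReal.ofReal ((Hn.toProcess s.toNNReal ω - H s.toNNReal ω) ^ 2) +
        2 * ENNReal.ofReal ((Gn.toProcess s.toNNReal ω - H s.toNNReal ω) ^ 2) := by
    intro s
    rw [Hn.toProcess_sub Gn]
    set a := Hn.toProcess s.toNNReal ω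
    set b := Gn.toProcess s.toNNReal ω
    set c := H s.toNNReal ω
    have h : (a - b) ^ 2 ≤ 2 * (a - c) ^ 2 + 2 * (b - c) ^ 2 := by
      nlinarith [sq_nonneg (a - c + (b - c))]
    calc ENNReal.ofReal ((a - b) ^ 2) ≤ ENNReal.ofReal (2 * (a - c) ^ 2 + 2 * (b - c) ^ 2) :=
          ENNReal.ofReal_le_ofReal h
      _ = 2 * ENNReal.ofReal ((a - c) ^ 2) + 2 * ENNReal.ofReal ((b - c) ^ 2) := by
          rw [ENNReal.ofReal_add (by positivity) (by positivity), ENNReal.ofReal_mul zero_le_two,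
            ENNReal.ofReal_mul zero_le_two, ENNReal.ofReal_ofNat]
  calc ∫⁻ s in Set.Icc (0 : ℝ) t, ENNReal.ofReal (((Hn.sub Gn).toProcess s.toNNReal ω) ^ 2)
      ≤ ∫⁻ s in Set.Icc (0 : ℝ) t, (2 * ENNReal.ofReal ((Hn.toProcess s.toNNReal ω - H s.toNNReal ω) ^ 2) +
          2 * ENNReal.ofReal ((Gn.toProcess s.toNNReal ω - H s.toNNReal ω) ^ 2)) :=
        lintegral_mono fun s ↦ hpt s
    _ = _ := by
        have hf : Measurable fun s : ℝ ↦
            ENNReal.ofReal ((Hn.toProcess s.toNNReal ω - H s.toNNReal ω) ^ 2) :=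
          (((Hn.measurable_toProcess_prod.comp (measurable_prodMk_left (x := ω))).sub (hH ω)).pow_const 2).ennreal_ofReal
        have hg : Measurable fun s : ℝ ↦
            ENNReal.ofReal ((Gn.toProcess s.toNNReal ω - H s.toNNReal ω) ^ 2) :=
          (((Gn.measurable_toProcess_prod.comp (measurable_prodMk_left (x := ω))).sub (hH ω)).pow_const 2).ennreal_ofReal
        rw [lintegral_add_left (hf.const_mul 2), lintegral_const_mul _ hf, lintegral_const_mul _ hg]

/-- **The basic estimate for two approximants**: for simple `Hₙ, Gₙ'`, any integrand `H` with
Borel paths, `ε, η > 0`: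
`μ {∃ s ≤ t, ε ≤ |(Hₙ·B)_s - (Gₙ'·B)_s|} ≤ μ {η/4 ≤ ∫₀ᵗ(Hₙ-H)²} + μ {η/4 ≤ ∫₀ᵗ(Gₙ'-H)²} + η/ε²`.
Revuz–Yor, *Continuous Martingales and Brownian Motion* (1999), Ch. IV, proof of Thm (2.12)
and Prop. (2.13). [folklore] -/
theorem measure_exists_le_abs_integral_sub_le (Hn Gn : SimpleProcess m 𝓕) {H : ℝ≥0 → Ω → ℝ}
    (hH : ∀ ω, Measurable fun s : ℝ ↦ H s.toNNReal ω) (hB : Martingale B 𝓕 μ)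
    (hBsq : Martingale (fun t ω ↦ B t ω ^ 2 - (t : ℝ)) 𝓕 μ) (hB2 : ∀ t, MemLp (B t) 2 μ)
    (hBc : ∀ ω, Continuous (B · ω)) (t : ℝ≥0) {ε η : ℝ} (hε : 0 < ε) (hη : 0 < η) :
    μ {ω | ∃ s ≤ t, ε ≤ |Hn.integral B s ω - Gn.integral B s ω|} ≤
      μ {ω | ENNReal.ofReal (η / 4) ≤ ∫⁻ s in Set.Icc (0 : ℝ) t,
          ENNReal.ofReal ((Hn.toProcess s.toNNReal ω - H s.toNNReal ω) ^ 2)} +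
      μ {ω | ENNReal.ofReal (η / 4) ≤ ∫⁻ s in Set.Icc (0 : ℝ) t,
          ENNReal.ofReal ((Gn.toProcess s.toNNReal ω - H s.toNNReal ω) ^ 2)} +
        ENNReal.ofReal (η / ε ^ 2) := by
  have h1 := (Hn.sub Gn).measure_exists_le_abs_integral_le hB hBsq hB2 hBc t hε hη
  have heq : {ω | ∃ s ≤ t, ε ≤ |Hn.integral B s ω - Gn.integral B s ω|} =
      {ω | ∃ s ≤ t, ε ≤ |(Hn.sub Gn).integral B s ω|} := by
    ext ω; simp only [Set.mem_setOf_eq, Hn.integral_sub Gn B]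
  rw [heq]
  refine h1.trans ?_
  gcongr ?_ + _
  -- `{η < ∫₀ᵗ (Hₙ - Gₙ)²} ⊆ {η/4 ≤ ∫₀ᵗ (Hₙ - H)²} ∪ {η/4 ≤ ∫₀ᵗ (Gₙ - H)²}`
  refine (measure_mono fun ω hω ↦ ?_).trans (measure_union_le _ _)
  simp only [Set.mem_setOf_eq, Set.mem_union] at hω ⊢
  by_contra hcon
  push Not at hcon
  have hle := Hn.ofReal_setIntegral_sub_sq_le Gn hH t ω
  have hlt : ENNReal.ofReal (∫ s in Set.Icc (0 : ℝ) t, ((Hn.sub Gn).toProcess s.toNNReal ω) ^ 2) <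
      ENNReal.ofReal η := by
    refine hle.trans_lt ?_
    calc 2 * (∫⁻ s in Set.Icc (0 : ℝ) t,
            ENNReal.ofReal ((Hn.toProcess s.toNNReal ω - H s.toNNReal ω) ^ 2)) +
          2 * (∫⁻ s in Set.Icc (0 : ℝ) t,
            ENNReal.ofReal ((Gn.toProcess s.toNNReal ω - H s.toNNReal ω) ^ 2))
        < 2 * ENNReal.ofReal (η / 4) + 2 * ENNReal.ofReal (η / 4) := by
          refine ENNReal.add_lt_add ?_ ?_
          · exact (ENNReal.mul_lt_mul_iff_right (by norm_num) ENNReal.ofNat_ne_top).2 hcon.1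
          · exact (ENNReal.mul_lt_mul_iff_right (by norm_num) ENNReal.ofNat_ne_top).2 hcon.2
      _ = ENNReal.ofReal η := by
          rw [← ENNReal.ofReal_ofNat 2, ← ENNReal.ofReal_mul (by norm_num),
            ← ENNReal.ofReal_add (by positivity) (by positivity)]
          congr 1; ring
  exact (not_lt.2 hω.le) ((ENNReal.ofReal_lt_ofReal_iff hη).1 hlt)

end Estimate

end SimpleProcess

/-! ### u.c.p. equivalence of approximating sequences and the u.c.p. limit -/

section Limit

variable [IsProbabilityMeasure μ] {B : ℝ≥0 → Ω → ℝ} {H : ℝ≥0 → Ω → ℝ}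

/-- Threshold bookkeeping: for `ε > 0` and `δ > 0` in `ℝ≥0∞` there is `η > 0` with
`η / ε² ≤ δ / 2` (as extended reals). [folklore] -/
theorem exists_pos_ofReal_div_sq_le {ε : ℝ} (hε : 0 < ε) {δ : ℝ≥0∞} (hδ : 0 < δ) :
    ∃ η : ℝ, 0 < η ∧ ENNReal.ofReal (η / ε ^ 2) ≤ δ / 2 := by
  set δ' : ℝ≥0∞ := min δ 1 with hδ'
  have hδ'pos : 0 < δ' := lt_min hδ one_pos
  have hδ'top : δ' ≠ ∞ := ne_top_of_le_ne_top ENNReal.one_ne_top (min_le_right _ _)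
  have hδ'le : δ' ≤ δ := min_le_left _ _
  have hδ'real : 0 < δ'.toReal := ENNReal.toReal_pos hδ'pos.ne' hδ'top
  refine ⟨ε ^ 2 * (δ'.toReal / 2), by positivity, ?_⟩
  have : ε ^ 2 * (δ'.toReal / 2) / ε ^ 2 = δ'.toReal / 2 := by field_simp
  rw [this, ENNReal.ofReal_div_of_pos two_pos, ENNReal.ofReal_toReal hδ'top, ENNReal.ofReal_ofNat]
  gcongr

/-- **Two approximating sequences of one integrand have u.c.p.-equivalent elementary integrals**:
if `Hₙ` and `Gₙ` both approximate `H` (`IsApproxSeq`), then for every `t` and `ε > 0`,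
`μ {∃ s ≤ t, ε ≤ |(Hₙ·B)_s - (Gₙ·B)_s|} → 0`.
Revuz–Yor, *Continuous Martingales and Brownian Motion* (1999), Ch. IV, Prop. (2.13) and the
proof of Thm (2.12). [cite: RevuzYor1999, Ch. IV Prop. (2.13)] -/
theorem tendsto_measure_integral_sub_of_isApproxSeq {Hn Gn : ℕ → SimpleProcess m 𝓕}
    (hHn : SimpleProcess.IsApproxSeq Hn H μ) (hGn : SimpleProcess.IsApproxSeq Gn H μ)
    (hH : ∀ ω, Measurable fun s : ℝ ↦ H s.toNNReal ω) (hB : Martingale B 𝓕 μ)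
    (hBsq : Martingale (fun t ω ↦ B t ω ^ 2 - (t : ℝ)) 𝓕 μ) (hB2 : ∀ t, MemLp (B t) 2 μ)
    (hBc : ∀ ω, Continuous (B · ω)) (t : ℝ≥0) {ε : ℝ} (hε : 0 < ε) :
    Tendsto (fun n ↦ μ {ω | ∃ s ≤ t, ε ≤ |(Hn n).integral B s ω - (Gn n).integral B s ω|})
      atTop (𝓝 0) := by
  rw [ENNReal.tendsto_nhds_zero]
  intro δ hδ
  obtain ⟨η, hηpos, hηε⟩ := exists_pos_ofReal_div_sq_le hε hδ
  have hη4 : 0 < η / 4 := by positivity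
  have h1 := hHn t (η / 4) hη4
  have h2 := hGn t (η / 4) hη4
  rw [ENNReal.tendsto_nhds_zero] at h1 h2
  have hδ2 : 0 < δ / 2 := by simpa using hδ.ne'
  have hδ4 : 0 < δ / 2 / 2 := by simpa using hδ2.ne'
  filter_upwards [h1 (δ / 2 / 2) hδ4, h2 (δ / 2 / 2) hδ4] with n hn1 hn2
  calc μ {ω | ∃ s ≤ t, ε ≤ |(Hn n).integral B s ω - (Gn n).integral B s ω|}
      ≤ _ := (Hn n).measure_exists_le_abs_integral_sub_le (Gn n) hH hB hBsq hB2 hBc t hε hηpos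
    _ ≤ δ / 2 / 2 + δ / 2 / 2 + δ / 2 := by gcongr
    _ = δ := by rw [ENNReal.add_halves, ENNReal.add_halves]

/-- **Existence of the u.c.p. limit of elementary integrals.** Let `B` be a continuous
square-integrable martingale with `B_t² - t` a martingale, and let `Hₙ` be simple processes
approximating an integrand `H` with Borel paths (`IsApproxSeq`). Then the elementary integrals
`Hₙ·B` are Cauchy uniformly on compacts in probability, and there is a process `J`, strongly
adapted to the *same* (raw) filtration, with a.s. continuous paths and `J 0 = 0`, such that
`Gₙ·B → J` u.c.p. along **every** approximating sequence `Gₙ` of `H`, and `J` is the a.s.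
locally uniform limit of a subsequence `H_{φ k}·B`.
Revuz–Yor, *Continuous Martingales and Brownian Motion* (1999), Ch. IV, Thm (2.2) (extension
of `K ↦ K·M` by isometry), Prop. (2.13) and the proof of Thm (2.12).
[cite: RevuzYor1999, Ch. IV Thm (2.2) and Prop. (2.13)] -/
theorem exists_ucpLimit_integral {Hn : ℕ → SimpleProcess m 𝓕}
    (hHn : SimpleProcess.IsApproxSeq Hn H μ) (hH : ∀ ω, Measurable fun s : ℝ ↦ H s.toNNReal ω)
    (hB : Martingale B 𝓕 μ) (hBsq : Martingale (fun t ω ↦ B t ω ^ 2 - (t : ℝ)) 𝓕 μ)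
    (hB2 : ∀ t, MemLp (B t) 2 μ) (hBc : ∀ ω, Continuous (B · ω)) :
    ∃ J : ℝ≥0 → Ω → ℝ, StronglyAdapted 𝓕 J ∧ (∀ᵐ ω ∂μ, Continuous (J · ω)) ∧ (∀ ω, J 0 ω = 0) ∧
      (∀ Gn : ℕ → SimpleProcess m 𝓕, SimpleProcess.IsApproxSeq Gn H μ →
        TendstoUCP (fun n ↦ (Gn n).integral B) J μ) ∧
      ∃ φ : ℕ → ℕ, StrictMono φ ∧ ∀ᵐ ω ∂μ, ∀ t : ℝ≥0,
        TendstoUniformlyOn (fun k s ↦ (Hn (φ k)).integral B s ω) (J · ω) atTop (Set.Iic t) := by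
  -- the elementary integrals are u.c.p.-Cauchy
  have hcauchy : ∀ (t : ℝ≥0) (ε : ℝ), 0 < ε → ∀ δ : ℝ≥0∞, 0 < δ →
      ∃ N, ∀ n ≥ N, ∀ n' ≥ N,
        μ {ω | ∃ s ≤ t, ε ≤ |(Hn n).integral B s ω - (Hn n').integral B s ω|} ≤ δ := by
    intro t ε hε δ hδ
    obtain ⟨η, hηpos, hηε⟩ := exists_pos_ofReal_div_sq_le hε hδ
    have hη4 : 0 < η / 4 := by positivity
    have h1 := hHn t (η / 4) hη4
    rw [ENNReal.tendsto_nhds_zero] at h1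
    have hδ2 : 0 < δ / 2 := by simpa using hδ.ne'
    have hδ4 : 0 < δ / 2 / 2 := by simpa using hδ2.ne'
    obtain ⟨N, hN⟩ := eventually_atTop.1 (h1 (δ / 2 / 2) hδ4)
    refine ⟨N, fun n hn n' hn' ↦ ?_⟩
    calc μ {ω | ∃ s ≤ t, ε ≤ |(Hn n).integral B s ω - (Hn n').integral B s ω|}
        ≤ _ := (Hn n).measure_exists_le_abs_integral_sub_le (Hn n') hH hB hBsq hB2 hBc t hε hηpos
      _ ≤ δ / 2 / 2 + δ / 2 / 2 + δ / 2 := by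
          gcongr
          · exact hN n hn
          · exact hN n' hn'
      _ = δ := by rw [ENNReal.add_halves, ENNReal.add_halves]
  obtain ⟨J, hJa, hJc, hJ0, hJucp, φ, hφ, hunif⟩ := exists_tendstoUCP_of_cauchy
    (fun n ↦ (Hn n).stronglyAdapted_integral hB.stronglyAdapted)
    (fun n ω ↦ (Hn n).continuous_integral (hBc ω)) hcauchy
  refine ⟨J, hJa, hJc, fun ω ↦ hJ0 ω fun n ↦ (Hn n).integral_zero B ω, fun Gn hGn ↦ ?_,
    φ, hφ, hunif⟩
  exact hJucp.of_sub fun t ε hε ↦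
    tendsto_measure_integral_sub_of_isApproxSeq hGn hHn hH hB hBsq hB2 hBc t hε

end Limit

/-! ### Square-integrable integrands: `L²` convergence and the martingale property -/

namespace SimpleProcess

/-- The squared `L²(ds ⊗ μ)` approximation error of the integrand `H` by the simple process
`K` on `[0, t]`: `∫⁻ ∫⁻_{[0,t]} (K(s) - H(s))² ds dμ` — the square of the seminorm of
`L²(B)` restricted to `[0, t]` when `⟨B⟩_s = s`.
Revuz–Yor, *Continuous Martingales and Brownian Motion* (1999), Ch. IV, Def. (2.1) and
Def. (2.9). [folklore] -/
noncomputable def approxErr (K : SimpleProcess m 𝓕) (H : ℝ≥0 → Ω → ℝ) (μ : Measure Ω)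
    (t : ℝ≥0) : ℝ≥0∞ :=
  ∫⁻ ω, (∫⁻ s in Set.Icc (0 : ℝ) t,
    ENNReal.ofReal ((K.toProcess s.toNNReal ω - H s.toNNReal ω) ^ 2)) ∂μ

/-- Unfolding of `approxErr`. [folklore] -/
theorem approxErr_def (K : SimpleProcess m 𝓕) (H : ℝ≥0 → Ω → ℝ) (μ : Measure Ω) (t : ℝ≥0) :
    K.approxErr H μ t = ∫⁻ ω, (∫⁻ s in Set.Icc (0 : ℝ) t,
      ENNReal.ofReal ((K.toProcess s.toNNReal ω - H s.toNNReal ω) ^ 2)) ∂μ := rfl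

/-- The integrand of the approximation error is jointly measurable when `H` is. [folklore] -/
theorem measurable_approxErr_integrand (K : SimpleProcess m 𝓕) {H : ℝ≥0 → Ω → ℝ}
    (hHm : Measurable fun p : Ω × ℝ ↦ H p.2.toNNReal p.1) :
    Measurable fun p : Ω × ℝ ↦
      ENNReal.ofReal ((K.toProcess p.2.toNNReal p.1 - H p.2.toNNReal p.1) ^ 2) :=
  ((K.measurable_toProcess_prod.sub hHm).pow_const 2).ennreal_ofReal

/-- `ω ↦ ∫⁻_{[0,t]} (K - H)²` is measurable when `H` is jointly measurable. [folklore] -/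
theorem measurable_lintegral_sub_sq (K : SimpleProcess m 𝓕) {H : ℝ≥0 → Ω → ℝ}
    (hHm : Measurable fun p : Ω × ℝ ↦ H p.2.toNNReal p.1) (t : ℝ≥0) :
    Measurable fun ω ↦ ∫⁻ s in Set.Icc (0 : ℝ) t,
      ENNReal.ofReal ((K.toProcess s.toNNReal ω - H s.toNNReal ω) ^ 2) :=
  (K.measurable_approxErr_integrand hHm).lintegral_prod_right'

/-- **Approximation in `L²(ds ⊗ μ)` implies approximation in probability** (`IsApproxSeq`), by
Markov's inequality, provided the error tends to `0` on every `[0, t]`.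
Revuz–Yor, *Continuous Martingales and Brownian Motion* (1999), Ch. IV, Def. (2.9) and
Prop. (2.13). [folklore] -/
theorem isApproxSeq_of_tendsto_approxErr {Hn : ℕ → SimpleProcess m 𝓕} {H : ℝ≥0 → Ω → ℝ}
    (hHm : Measurable fun p : Ω × ℝ ↦ H p.2.toNNReal p.1)
    (h : ∀ t : ℝ≥0, Tendsto (fun n ↦ (Hn n).approxErr H μ t) atTop (𝓝 0)) :
    IsApproxSeq Hn H μ := by
  intro t ε hε
  have hε' : ENNReal.ofReal ε ≠ 0 := (ENNReal.ofReal_pos.2 hε).ne'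
  have hle : ∀ n, μ {ω | ENNReal.ofReal ε ≤ ∫⁻ s in Set.Icc (0 : ℝ) t,
      ENNReal.ofReal (((Hn n).toProcess s.toNNReal ω - H s.toNNReal ω) ^ 2)} ≤
      (Hn n).approxErr H μ t / ENNReal.ofReal ε := fun n ↦
    meas_ge_le_lintegral_div ((Hn n).measurable_lintegral_sub_sq hHm t).aemeasurable hε'
      ENNReal.ofReal_ne_top
  have hlim : Tendsto (fun n ↦ (Hn n).approxErr H μ t / ENNReal.ofReal ε) atTop (𝓝 0) := by
    simpa [ENNReal.zero_div] using ENNReal.Tendsto.div_const (h t) (Or.inr hε')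
  exact tendsto_of_tendsto_of_tendsto_of_le_of_le tendsto_const_nhds hlim (fun n ↦ bot_le) hle

end SimpleProcess

section Martingale

variable {B : ℝ≥0 → Ω → ℝ} {H : ℝ≥0 → Ω → ℝ}

/-- `L¹ ≤ L²` on a probability space, in `ℝ≥0∞` form: `∫⁻ ‖f‖ₑ ≤ (∫⁻ f²)^{1/2}`. [folklore] -/
theorem lintegral_enorm_le_sqrt_lintegral_sq [IsProbabilityMeasure μ] {f : Ω → ℝ}
    (hf : AEStronglyMeasurable f μ) :
    ∫⁻ ω, ‖f ω‖ₑ ∂μ ≤ (∫⁻ ω, ENNReal.ofReal (f ω ^ 2) ∂μ) ^ (1 / 2 : ℝ) := by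
  have h := ENNReal.lintegral_mul_le_Lp_mul_Lq μ Real.HolderConjugate.two_two
    (f := fun ω ↦ ‖f ω‖ₑ) (g := fun _ ↦ 1) hf.aemeasurable.enorm aemeasurable_const
  simp only [Pi.mul_apply, mul_one, one_pow, ENNReal.one_rpow, lintegral_const, measure_univ,
    ENNReal.rpow_two] at h
  have heq : ∀ ω, ‖f ω‖ₑ ^ 2 = ENNReal.ofReal (f ω ^ 2) := fun ω ↦ by
    rw [Real.enorm_eq_ofReal_abs, ← ENNReal.ofReal_pow (abs_nonneg _), sq_abs]
  simpa only [heq] using h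

/-- A real function with finite `∫⁻ f²` is in `L²`. [folklore] -/
theorem memLp_two_of_lintegral_sq_ne_top {f : Ω → ℝ} (hf : AEStronglyMeasurable f μ)
    (h : ∫⁻ ω, ENNReal.ofReal (f ω ^ 2) ∂μ ≠ ∞) : MemLp f 2 μ := by
  rw [memLp_two_iff_integrable_sq hf]
  refine ⟨hf.pow 2, ?_⟩
  rw [hasFiniteIntegral_iff_ofReal (ae_of_all _ fun ω ↦ sq_nonneg (f ω))]
  exact lt_top_iff_ne_top.2 h

variable [IsProbabilityMeasure μ] {Hn : ℕ → SimpleProcess m 𝓕} {J : ℝ≥0 → Ω → ℝ} {φ : ℕ → ℕ}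

/-- **`L²` control of the u.c.p. limit by Fatou**: if `H_{φ k}·B → J` a.s. at time `t` along a
subsequence whose `L²(ds ⊗ μ)` errors on `[0, t]` tend to `0`, then
`∫⁻ ((Hₙ·B)_t - J_t)² ≤ 2 · approxErr Hₙ` (isometry for the simple differences `Hₙ - H_{φ k}`
and Fatou's lemma).
Revuz–Yor, *Continuous Martingales and Brownian Motion* (1999), Ch. IV, Thm (2.2) (the
isometric extension of `K ↦ K·M`). [folklore] -/
theorem lintegral_integral_sub_limit_sq_le (hHm : Measurable fun p : Ω × ℝ ↦ H p.2.toNNReal p.1)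
    (hB : Martingale B 𝓕 μ) (hBsq : Martingale (fun t ω ↦ B t ω ^ 2 - (t : ℝ)) 𝓕 μ)
    (hB2 : ∀ t, MemLp (B t) 2 μ) (t : ℝ≥0)
    (hae : ∀ᵐ ω ∂μ, Tendsto (fun k ↦ (Hn (φ k)).integral B t ω) atTop (𝓝 (J t ω)))
    (hconv : Tendsto (fun k ↦ (Hn (φ k)).approxErr H μ t) atTop (𝓝 0)) (n : ℕ) :
    ∫⁻ ω, ENNReal.ofReal (((Hn n).integral B t ω - J t ω) ^ 2) ∂μ ≤ 2 * (Hn n).approxErr H μ t := by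
  have hH : ∀ ω, Measurable fun s : ℝ ↦ H s.toNNReal ω := fun ω ↦ hHm.comp measurable_prodMk_left
  -- Fatou: the integrand is the a.e. limit of `((Hₙ·B)_t - (H_{φ k}·B)_t)²`
  have hmeas : ∀ k, Measurable fun ω ↦
      ENNReal.ofReal (((Hn n).integral B t ω - (Hn (φ k)).integral B t ω) ^ 2) := by
    intro k
    exact (((((Hn n).stronglyMeasurable_integral hB.stronglyAdapted t).mono (𝓕.le t)).measurable.sub
      (((Hn (φ k)).stronglyMeasurable_integral hB.stronglyAdapted t).mono
        (𝓕.le t)).measurable).pow_const 2).ennreal_ofReal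
  have hlim : ∀ᵐ ω ∂μ, ENNReal.ofReal (((Hn n).integral B t ω - J t ω) ^ 2) =
      liminf (fun k ↦ ENNReal.ofReal (((Hn n).integral B t ω - (Hn (φ k)).integral B t ω) ^ 2))
        atTop := by
    filter_upwards [hae] with ω hω
    refine (Tendsto.liminf_eq ?_).symm
    exact (ENNReal.continuous_ofReal.tendsto _).comp ((tendsto_const_nhds.sub hω).pow 2)
  have hFatou : ∫⁻ ω, ENNReal.ofReal (((Hn n).integral B t ω - J t ω) ^ 2) ∂μ ≤
      liminf (fun k ↦ ∫⁻ ω,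
        ENNReal.ofReal (((Hn n).integral B t ω - (Hn (φ k)).integral B t ω) ^ 2) ∂μ) atTop := by
    rw [lintegral_congr_ae hlim]
    exact lintegral_liminf_le hmeas
  -- isometry for the differences and the pathwise bound
  have hiso : ∀ k, ∫⁻ ω, ENNReal.ofReal (((Hn n).integral B t ω - (Hn (φ k)).integral B t ω) ^ 2) ∂μ
      ≤ 2 * (Hn n).approxErr H μ t + 2 * (Hn (φ k)).approxErr H μ t := by
    intro k
    have h1 := ((Hn n).sub (Hn (φ k))).lintegral_integral_sq hB hBsq hB2 t
    have h2 : ∀ ω, ((Hn n).sub (Hn (φ k))).integral B t ω =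
        (Hn n).integral B t ω - (Hn (φ k)).integral B t ω := fun ω ↦ (Hn n).integral_sub _ B t ω
    simp only [h2] at h1
    rw [h1]
    calc ∫⁻ ω, (∫⁻ s in Set.Icc (0 : ℝ) t,
          ENNReal.ofReal ((((Hn n).sub (Hn (φ k))).toProcess s.toNNReal ω) ^ 2)) ∂μ
        ≤ ∫⁻ ω, (2 * (∫⁻ s in Set.Icc (0 : ℝ) t,
            ENNReal.ofReal (((Hn n).toProcess s.toNNReal ω - H s.toNNReal ω) ^ 2)) +
          2 * (∫⁻ s in Set.Icc (0 : ℝ) t,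
            ENNReal.ofReal (((Hn (φ k)).toProcess s.toNNReal ω - H s.toNNReal ω) ^ 2))) ∂μ := by
          refine lintegral_mono fun ω ↦ ?_
          rw [← ((Hn n).sub (Hn (φ k))).ofReal_setIntegral_toProcess_sq t ω]
          exact (Hn n).ofReal_setIntegral_sub_sq_le (Hn (φ k)) hH t ω
      _ = 2 * (Hn n).approxErr H μ t + 2 * (Hn (φ k)).approxErr H μ t := by
          rw [lintegral_add_left (((Hn n).measurable_lintegral_sub_sq hHm t).const_mul 2),
            lintegral_const_mul _ ((Hn n).measurable_lintegral_sub_sq hHm t),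
            lintegral_const_mul _ ((Hn (φ k)).measurable_lintegral_sub_sq hHm t)]
          rfl
  have hlim2 : Tendsto (fun k ↦ 2 * (Hn n).approxErr H μ t + 2 * (Hn (φ k)).approxErr H μ t)
      atTop (𝓝 (2 * (Hn n).approxErr H μ t)) := by
    have := ENNReal.Tendsto.const_mul hconv (Or.inr ENNReal.ofNat_ne_top) (a := 2)
    simpa using tendsto_const_nhds.add this
  calc ∫⁻ ω, ENNReal.ofReal (((Hn n).integral B t ω - J t ω) ^ 2) ∂μ
      ≤ liminf (fun k ↦ ∫⁻ ω,
          ENNReal.ofReal (((Hn n).integral B t ω - (Hn (φ k)).integral B t ω) ^ 2) ∂μ) atTop := hFatou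
    _ ≤ liminf (fun k ↦ 2 * (Hn n).approxErr H μ t + 2 * (Hn (φ k)).approxErr H μ t) atTop :=
        liminf_le_liminf (Eventually.of_forall hiso)
    _ = 2 * (Hn n).approxErr H μ t := hlim2.liminf_eq

/-- **`L²` convergence at fixed times**: under `L²(ds ⊗ μ)` approximation on `[0, t]`,
`(Hₙ·B)_t → J_t` in `L²`, i.e. `∫⁻ ((Hₙ·B)_t - J_t)² → 0`.
Revuz–Yor, *Continuous Martingales and Brownian Motion* (1999), Ch. IV, Thm (2.2). [folklore] -/
theorem tendsto_lintegral_integral_sub_limit_sq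
    (hHm : Measurable fun p : Ω × ℝ ↦ H p.2.toNNReal p.1)
    (hB : Martingale B 𝓕 μ) (hBsq : Martingale (fun t ω ↦ B t ω ^ 2 - (t : ℝ)) 𝓕 μ)
    (hB2 : ∀ t, MemLp (B t) 2 μ) (hφ : StrictMono φ) (t : ℝ≥0)
    (hae : ∀ᵐ ω ∂μ, Tendsto (fun k ↦ (Hn (φ k)).integral B t ω) atTop (𝓝 (J t ω)))
    (hL2 : Tendsto (fun n ↦ (Hn n).approxErr H μ t) atTop (𝓝 0)) :
    Tendsto (fun n ↦ ∫⁻ ω, ENNReal.ofReal (((Hn n).integral B t ω - J t ω) ^ 2) ∂μ)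
      atTop (𝓝 0) := by
  have hconv : Tendsto (fun k ↦ (Hn (φ k)).approxErr H μ t) atTop (𝓝 0) :=
    hL2.comp hφ.tendsto_atTop
  have hle := lintegral_integral_sub_limit_sq_le hHm hB hBsq hB2 t hae hconv
  have hlim : Tendsto (fun n ↦ 2 * (Hn n).approxErr H μ t) atTop (𝓝 0) := by
    simpa using ENNReal.Tendsto.const_mul hL2 (Or.inr ENNReal.ofNat_ne_top) (a := 2)
  exact tendsto_of_tendsto_of_tendsto_of_le_of_le tendsto_const_nhds hlim (fun n ↦ bot_le) hle

/-- **The limit is square integrable** at every time (under `L²(ds ⊗ μ)` approximation).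
Revuz–Yor, *Continuous Martingales and Brownian Motion* (1999), Ch. IV, Thm (2.2)
(`K·M ∈ H²₀`). [folklore] -/
theorem memLp_limit_of_tendsto_approxErr
    (hHm : Measurable fun p : Ω × ℝ ↦ H p.2.toNNReal p.1)
    (hB : Martingale B 𝓕 μ) (hBsq : Martingale (fun t ω ↦ B t ω ^ 2 - (t : ℝ)) 𝓕 μ)
    (hB2 : ∀ t, MemLp (B t) 2 μ) (hJa : StronglyAdapted 𝓕 J) (hφ : StrictMono φ) (t : ℝ≥0)
    (hae : ∀ᵐ ω ∂μ, Tendsto (fun k ↦ (Hn (φ k)).integral B t ω) atTop (𝓝 (J t ω)))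
    (hL2 : Tendsto (fun n ↦ (Hn n).approxErr H μ t) atTop (𝓝 0)) : MemLp (J t) 2 μ := by
  have h := tendsto_lintegral_integral_sub_limit_sq hHm hB hBsq hB2 hφ t hae hL2
  obtain ⟨n, hn⟩ := (eventually_atTop.1 ((ENNReal.tendsto_nhds_zero.1 h) 1 one_pos))
  have hn1 := hn n le_rfl
  have hJm : AEStronglyMeasurable (J t) μ := ((hJa t).mono (𝓕.le t)).aestronglyMeasurable
  have hMm : AEStronglyMeasurable ((Hn n).integral B t) μ :=
    (((Hn n).stronglyMeasurable_integral hB.stronglyAdapted t).mono (𝓕.le t)).aestronglyMeasurable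
  have hdiff : MemLp (fun ω ↦ (Hn n).integral B t ω - J t ω) 2 μ :=
    memLp_two_of_lintegral_sq_ne_top (hMm.sub hJm) (ne_top_of_le_ne_top ENNReal.one_ne_top hn1)
  have heq : J t = fun ω ↦ (Hn n).integral B t ω - ((Hn n).integral B t ω - J t ω) := by
    ext ω; ring
  rw [heq]
  exact ((Hn n).memLp_integral hB2 t).sub hdiff

omit [IsProbabilityMeasure μ] in
/-- **`L¹` limits of martingales are martingales** (raw filtration): if `Mₙ` are martingales,
`J` is strongly adapted and integrable, and `∫⁻ ‖Mₙ r - J r‖ₑ → 0` for every `r`, then `J` is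
a martingale (the conditional expectation is an `L¹` contraction).
Revuz–Yor, *Continuous Martingales and Brownian Motion* (1999), Ch. IV, proof of Prop. (1.23)
/ Thm (2.2) ("a limit in `L¹` of martingales is a martingale"). [folklore] -/
theorem martingale_of_tendsto_lintegral_enorm_sub {M : ℕ → ℝ≥0 → Ω → ℝ}
    (hM : ∀ n, Martingale (M n) 𝓕 μ) (hJa : StronglyAdapted 𝓕 J) (hJi : ∀ r, Integrable (J r) μ)
    (hconv : ∀ r, Tendsto (fun n ↦ ∫⁻ ω, ‖M n r ω - J r ω‖ₑ ∂μ) atTop (𝓝 0)) :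
    Martingale J 𝓕 μ := by
  refine ⟨hJa, fun s t hst ↦ ?_⟩
  -- `∫⁻ ‖E[J_t | 𝓕 s] - J_s‖ₑ ≤ ∫⁻ ‖J_t - Mₙ t‖ₑ + ∫⁻ ‖Mₙ s - J_s‖ₑ` for every `n`
  have hbound : ∀ n, ∫⁻ ω, ‖(μ[J t | 𝓕 s]) ω - J s ω‖ₑ ∂μ ≤
      ∫⁻ ω, ‖M n t ω - J t ω‖ₑ ∂μ + ∫⁻ ω, ‖M n s ω - J s ω‖ₑ ∂μ := by
    intro n
    have h1 : μ[J t - M n t | 𝓕 s] =ᵐ[μ] μ[J t | 𝓕 s] - μ[M n t | 𝓕 s] :=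
      condExp_sub (hJi t) ((hM n).integrable t) _
    have h2 := (hM n).condExp_ae_eq hst
    have hae : ∀ᵐ ω ∂μ, (μ[J t | 𝓕 s]) ω - J s ω =
        (μ[J t - M n t | 𝓕 s]) ω + (M n s ω - J s ω) := by
      filter_upwards [h1, h2] with ω hω hω'
      rw [hω, Pi.sub_apply, hω']
      ring
    calc ∫⁻ ω, ‖(μ[J t | 𝓕 s]) ω - J s ω‖ₑ ∂μ
        = ∫⁻ ω, ‖(μ[J t - M n t | 𝓕 s]) ω + (M n s ω - J s ω)‖ₑ ∂μ :=
          lintegral_congr_ae (hae.mono fun ω hω ↦ by simp only [hω])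
      _ ≤ ∫⁻ ω, (‖(μ[J t - M n t | 𝓕 s]) ω‖ₑ + ‖M n s ω - J s ω‖ₑ) ∂μ :=
          lintegral_mono fun ω ↦ enorm_add_le _ _
      _ = ∫⁻ ω, ‖(μ[J t - M n t | 𝓕 s]) ω‖ₑ ∂μ + ∫⁻ ω, ‖M n s ω - J s ω‖ₑ ∂μ := by
          rw [lintegral_add_left']
          exact (stronglyMeasurable_condExp.mono (𝓕.le s)).aestronglyMeasurable.aemeasurable.enorm
      _ ≤ ∫⁻ ω, ‖(J t - M n t) ω‖ₑ ∂μ + ∫⁻ ω, ‖M n s ω - J s ω‖ₑ ∂μ := by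
          gcongr ?_ + _
          have := eLpNorm_condExp_le_eLpNorm (μ := μ) (m := 𝓕 s) (J t - M n t) (p := 1) le_rfl
          simpa only [eLpNorm_one_eq_lintegral_enorm] using this
      _ = ∫⁻ ω, ‖M n t ω - J t ω‖ₑ ∂μ + ∫⁻ ω, ‖M n s ω - J s ω‖ₑ ∂μ := by
          congr 1
          refine lintegral_congr fun ω ↦ ?_
          rw [Pi.sub_apply, ← enorm_neg, neg_sub]
  have hlim : Tendsto (fun n ↦ ∫⁻ ω, ‖M n t ω - J t ω‖ₑ ∂μ + ∫⁻ ω, ‖M n s ω - J s ω‖ₑ ∂μ)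
      atTop (𝓝 0) := by simpa using (hconv t).add (hconv s)
  have hzero : ∫⁻ ω, ‖(μ[J t | 𝓕 s]) ω - J s ω‖ₑ ∂μ = 0 :=
    le_antisymm (ge_of_tendsto' hlim hbound) bot_le
  have hmeas : AEMeasurable (fun ω ↦ ‖(μ[J t | 𝓕 s]) ω - J s ω‖ₑ) μ :=
    ((stronglyMeasurable_condExp.mono (𝓕.le s)).measurable.sub
      ((hJa s).mono (𝓕.le s)).measurable).aemeasurable.enorm
  have := (lintegral_eq_zero_iff' hmeas).1 hzero
  filter_upwards [this] with ω hω
  simpa [sub_eq_zero] using hω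

/-- **The Itô integral of a square-integrable integrand is a martingale** (raw filtration, no
usual conditions): if `Hₙ → H` in `L²(ds ⊗ μ)` on every `[0, t]`, `J` is strongly adapted and
`H_{φ k}·B → J` a.s. at every time along a subsequence, then `(Hₙ·B)_t → J_t` in `L²` and `J`
is a square-integrable `𝓕`-martingale.
Revuz–Yor, *Continuous Martingales and Brownian Motion* (1999), Ch. IV, Thm (2.2)
(`K·M ∈ H²₀` for `K ∈ L²(M)`). [cite: RevuzYor1999, Ch. IV Thm (2.2)] -/
theorem martingale_limit_of_tendsto_approxErr
    (hHm : Measurable fun p : Ω × ℝ ↦ H p.2.toNNReal p.1)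
    (hB : Martingale B 𝓕 μ) (hBsq : Martingale (fun t ω ↦ B t ω ^ 2 - (t : ℝ)) 𝓕 μ)
    (hB2 : ∀ t, MemLp (B t) 2 μ) (hJa : StronglyAdapted 𝓕 J) (hφ : StrictMono φ)
    (hae : ∀ᵐ ω ∂μ, ∀ t : ℝ≥0, Tendsto (fun k ↦ (Hn (φ k)).integral B t ω) atTop (𝓝 (J t ω)))
    (hL2 : ∀ t : ℝ≥0, Tendsto (fun n ↦ (Hn n).approxErr H μ t) atTop (𝓝 0)) :
    Martingale J 𝓕 μ ∧ ∀ t, MemLp (J t) 2 μ := by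
  have hae' : ∀ t : ℝ≥0, ∀ᵐ ω ∂μ, Tendsto (fun k ↦ (Hn (φ k)).integral B t ω) atTop (𝓝 (J t ω)) :=
    fun t ↦ hae.mono fun ω hω ↦ hω t
  have hL2J : ∀ t, MemLp (J t) 2 μ := fun t ↦
    memLp_limit_of_tendsto_approxErr hHm hB hBsq hB2 hJa hφ t (hae' t) (hL2 t)
  refine ⟨martingale_of_tendsto_lintegral_enorm_sub (fun n ↦ (Hn n).martingale_integral hB) hJa
    (fun r ↦ (hL2J r).integrable one_le_two) fun r ↦ ?_, hL2J⟩
  -- `L¹` convergence from `L²` convergence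
  have h2 := tendsto_lintegral_integral_sub_limit_sq hHm hB hBsq hB2 hφ r (hae' r) (hL2 r)
  have hsqrt : Tendsto (fun n ↦ (∫⁻ ω, ENNReal.ofReal (((Hn n).integral B r ω - J r ω) ^ 2) ∂μ) ^
      (1 / 2 : ℝ)) atTop (𝓝 0) := by
    have := (ENNReal.continuous_rpow_const (y := (1 / 2 : ℝ))).tendsto 0
    rw [ENNReal.zero_rpow_of_pos (by norm_num)] at this
    exact this.comp h2
  refine tendsto_of_tendsto_of_tendsto_of_le_of_le tendsto_const_nhds hsqrt (fun n ↦ bot_le)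
    fun n ↦ ?_
  exact lintegral_enorm_le_sqrt_lintegral_sq
    ((((Hn n).stronglyMeasurable_integral hB.stronglyAdapted r).mono (𝓕.le r)).aestronglyMeasurable.sub
      ((hJa r).mono (𝓕.le r)).aestronglyMeasurable)

end Martingale

end Literature.Probability.Process
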